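import Mathlib

/-!
# Wild twist at the CM prime — the «residual disjointness» kernel lemma (arithmetic core)
(crux idea `wild-twist-at-cm-prime` on `UpperOffV0HSYPlus`, stmt-BirchSwinnertonDyer-19804; written bsd-idea-20 g14
(REV 6), docstring revised g16 (REV 8), 2026-08-28)

Imports only Mathlib; no instance, no notation.  No summit statement is proved by this file.

STATUS (REV 8, after `WildTwistK3R-g15.md` §3.0 (E1)–(E4) and critic idea-crit-15 VERDICT #22j, 2026-08-28):
TRUE, UNUSED.  The theorems below are correct and kernel-checked, and their statements are unchanged since g14; but
the pair of residual constituents they certify as non-isomorphic — the Frobenius orbits of the characters `u·χ₀⁻¹`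
and `u·χ₀` of `Γ = μ₃ × I` — is NOT the pair that occurs in the coupled Kolyvagin system.  By the definitions of the
write-ups (`WildTwistK2R-g14.md` §1, `WildTwistK3R-g15.md` §1.2/§3.0), with `A = A(q)^{(d)}`, `K = ℚ(√−q)`,
`I = Gal(H_{q^k}/K) ≅ ℤ/q^k`, `χ₀ : I → μ_{q^k} ⊂ R₀ = ℤ[ζ_{q^k}]`, `R = R₀ ⊗ ℤ₂ = ∏_μ R_μ`, `O₂ = 𝒪_K ⊗ ℤ₂ = W(𝔽₄)`:
  * rank-one side  `X = B′^{χ} ≅ A ⊗_{𝒪_K} R₀`:  `X[2^M]_μ = A[2^M] ⊗_{O₂} R_μ`, the group `I` acting TRIVIALLY,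
    `K(X[2^M]) = K(A[2^M])`; every `𝔽₂[Γ]`-composition factor of `X[2^M]` is `≅ A[2]`;
  * rank-zero side `X′ = B′^{χ̄} = B″`:  `X′[2^M]_μ = A[2^M] ⊗_{O₂} R_μ(χ₀²)`, `I` acting FAITHFULLY,
    `K(X′[2^M]) = F_M := K(A[2^M])·H_{q^k}`; every composition factor is `≅ k_μ(u·χ₀²)`, simple of `𝔽₂`-dimension
    `2f`, `f = ord(2 mod q^k)/2`.
The disjointness that THEOREM K2_R / K3_R need («no common `𝔽₂[Γ]`-composition factor between `X[2^M]` and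
`X′[2^M]`», whence `Hom_Γ = 0` between `X`-isotypic and `X′`-isotypic modules, `L_{S_X} ∩ L_{S_{X′}} = F_M`, and the
mixed Čebotarev Cor 3.2″_R at every level `2^M`) therefore holds for the TRIVIAL reason that `I` acts trivially on
the one side and non-trivially on the other (K3R §3.0 (E1)); no congruence on powers of `2` is needed.  The REV 6
slogan «the flip partners SHARE their 2-division field» was FALSE (`K(X[2^M]) ⊊ K(X′[2^M])`, K3R §3.0 (E4)) and
has been removed from the card in REV 8.  This file is kept as the record of a true, unused lemma.

WHAT THE THEOREMS SAY (unchanged).  For a prime `q ≡ 3 (mod 4)` and every `k ≥ 1` the system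

      `2^j ≡ 1 (mod 3)` and `2^j ≡ −1 (mod q^k)`

has no solution `j` (`no_common_frobenius_twist`): `2^j ≡ 1 (mod 3)` forces `j` even, then `2^j = (2^{j/2})²` is a
square and `−1 ≡ 2^j` would be a square mod `q`, contradicting `q ≡ 3 (mod 4)` (`ZMod.exists_sq_eq_neg_one_iff`).
Equivalently: no power of the absolute Frobenius fixes the cubic character `u` of `μ₃ = Gal(H₂/K)` on `A[2] ≅ 𝔽₄`
while inverting a faithful character of `I`, so the `𝔽₂[Γ]`-modules `k_μ(u·χ₀⁻¹)` and `k_μ(u·χ₀)` are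
non-isomorphic.  `cross_component`: if `−1 ∈ ⟨2⟩ ⊂ (ℤ/q^k)^×` (true at every layer for the Gross primes,
`WildTwistAllLayers.minusOne_mem_powers_two_layers`) then `−a·2^j = b` puts `b` in the `⟨2⟩`-coset of `a`, so
characters with exponents in different `⟨2⟩`-cosets (different primes `μ ≠ μ′ ∣ 2` of `ℚ(ζ_{q^k})`) are never
Frobenius-conjugate up to sign.  `neg_one_exponents_*`: the exponents `f` with `2^f ≡ −1` for the five Gross primes
and for `121 = 11²`.
-/

set_option linter.dupNamespace false

namespace Summit.BirchSwinnertonDyer.BirchSwinnertonDyer.Cruxes.UpperOffV0HSYPlus.WildTwistAtCMPrime.ResidualDisjointness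

/-- For a prime `q ≡ 3 (mod 4)`, no EVEN power of `2` is `≡ −1 (mod q)`. -/
theorem two_pow_ne_neg_one_of_even {q : ℕ} [Fact q.Prime] (hq4 : q % 4 = 3) {j : ℕ} (hj : Even j) :
    (2 : ZMod q) ^ j ≠ -1 := by
  obtain ⟨i, rfl⟩ := hj
  intro h
  have hsq : IsSquare (-1 : ZMod q) := ⟨2 ^ i, by rw [← h]; ring⟩
  exact (ZMod.exists_sq_eq_neg_one_iff.mp hsq) hq4

/-- Reduction from modulus `n` to a divisor `q ∣ n`. -/
theorem two_pow_eq_neg_one_of_dvd {q n : ℕ} (hqn : q ∣ n) {j : ℕ} (h : (2 : ZMod n) ^ j = -1) :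
    (2 : ZMod q) ^ j = -1 := by
  have := congrArg (ZMod.castHom hqn (ZMod q)) h
  rwa [map_pow, map_neg, map_one, map_ofNat] at this

/-- Layer `k`: for a prime `q ≡ 3 (mod 4)` and `k ≥ 1`, no even power of `2` is `≡ −1 (mod q^k)`. -/
theorem two_pow_ne_neg_one_layer {q : ℕ} [Fact q.Prime] (hq4 : q % 4 = 3) {k : ℕ} (hk : k ≠ 0) {j : ℕ}
    (hj : Even j) : (2 : ZMod (q ^ k)) ^ j ≠ -1 := fun h =>
  two_pow_ne_neg_one_of_even hq4 hj (two_pow_eq_neg_one_of_dvd (dvd_pow_self q hk) h)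

/-- In `ZMod 3`, `2 = −1`, so `2^j = 1 ↔ j` even. -/
theorem two_pow_eq_one_mod_three_iff (j : ℕ) : (2 : ZMod 3) ^ j = 1 ↔ Even j := by
  have h2 : (2 : ZMod 3) = -1 := by decide
  rw [h2]
  constructor
  · intro h
    by_contra hodd
    rw [Nat.not_even_iff_odd] at hodd
    rw [hodd.neg_one_pow] at h
    exact absurd h (by decide)
  · intro h
    exact h.neg_one_pow

/-- Arithmetic core of the (true, unused — see the module docstring STATUS) residual-disjointness lemma: no power
of the absolute Frobenius fixes the cubic CM character (`2^j ≡ 1 (mod 3)`) while inverting a faithful character of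
order `q^k` (`2^j ≡ −1 (mod q^k)`), for every prime `q ≡ 3 (mod 4)` and every layer `k ≥ 1`.  Hence the
`𝔽₂[μ₃ × I]`-modules `k_μ(u·χ₀⁻¹)` and `k_μ(u·χ₀)` are non-isomorphic (this pair does not occur in the coupled
system; the pair that occurs, `A[2]` vs `k_μ(u·χ₀²)`, is told apart by the `I`-action alone). -/
theorem no_common_frobenius_twist {q : ℕ} [Fact q.Prime] (hq4 : q % 4 = 3) {k : ℕ} (hk : k ≠ 0) :
    ¬ ∃ j : ℕ, (2 : ZMod 3) ^ j = 1 ∧ (2 : ZMod (q ^ k)) ^ j = -1 := by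
  rintro ⟨j, h3, hq⟩
  exact two_pow_ne_neg_one_layer hq4 hk ((two_pow_eq_one_mod_three_iff j).mp h3) hq

/-- Cross-component bookkeeping: if `−1` is a power of `u` (here `u = 2 mod q^k`), then `−a·u^j = b` places `b` in the
`⟨u⟩`-coset of `a`.  Used contrapositively: exponents in different `⟨2⟩`-cosets (different primes `μ ≠ μ′ ∣ 2` of
`ℚ(ζ_{q^k})`) never give isomorphic constituents. -/
theorem cross_component {M : Type*} [CommRing M] {u a b : M} {f j : ℕ} (hf : u ^ f = -1)
    (h : -a * u ^ j = b) : a * u ^ (f + j) = b := by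
  rw [pow_add, ← mul_assoc, mul_comm a, hf]
  simpa using h

/-- The five Gross primes with `h(−q) = 1` and `2` inert (`q ≡ 3 (mod 8)`), as in the Sketch. -/
def grossPrimesRD : List ℕ := [11, 19, 43, 67, 163]

/-- All five are `≡ 3 (mod 4)` (the only hypothesis of `no_common_frobenius_twist`). -/
theorem grossPrimesRD_mod_four : ∀ q ∈ grossPrimesRD, q % 4 = 3 := by decide

/-- Numerical sanity at layer `k = 1` (independent of the abstract proof): over one full period of `2 mod q`
(`ord = 10, 18, 14, 66, 162`) the exponents `j` with `2^j ≡ −1 (mod q)` are exactly `ord/2`, all ODD. -/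
theorem neg_one_exponents_11 : (List.range 10).filter (fun j => 2 ^ j % 11 == 10) = [5] := by decide
theorem neg_one_exponents_19 : (List.range 18).filter (fun j => 2 ^ j % 19 == 18) = [9] := by decide
theorem neg_one_exponents_43 : (List.range 14).filter (fun j => 2 ^ j % 43 == 42) = [7] := by decide
theorem neg_one_exponents_67 : (List.range 66).filter (fun j => 2 ^ j % 67 == 66) = [33] := by decide
theorem neg_one_exponents_163 : (List.range 162).filter (fun j => 2 ^ j % 163 == 162) = [81] := by decide

/-- Layer `k = 2` for `q = 11` (`ord(2 mod 121) = 110`): the unique exponent is `55`, odd. -/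
theorem neg_one_exponents_121 : (List.range 110).filter (fun j => 2 ^ j % 121 == 120) = [55] := by decide

end Summit.BirchSwinnertonDyer.BirchSwinnertonDyer.Cruxes.UpperOffV0HSYPlus.WildTwistAtCMPrime.ResidualDisjointness
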